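import Summits.SmoothPoincare4.SmoothPoincare4.Theorems.NilpotentShadowsStandard.Negative.LoadBearing

/-!
# `NilpotentShadowsStandard` — negative-side support: the shape of a counterexample
# (crux `stmt-SmoothPoincare4-14594`, route `CongruenceShadows`)

Standing-disprover lemmas (refuter, cdisprove cycle 1). Nothing here asserts a Theses statement.

* `shadow_of_iso`, `shadow_mono`, `counterexample_shape` — `Iso N K` gives standard shadows at every
  level and shadows are monotone in the level; hence `¬ NilpotentShadowsStandard` produces a
  `(3+3m, m+1)` group trisection of `{1}` NOT `Iso` to the standard one (by Abrams–Gay–Kirby Thm 5 a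
  non-standard genus-`(3+3m)` trisection of a homotopy 4-sphere: an exotic `S⁴` or a counterexample to
  4-dimensional Waldhausen) together with a threshold level `c₀ ≥ 0` separating standard from
  non-standard shadows.
-/

noncomputable section

-- the prescribed namespace `Summit.<P>.<Sub>.…` duplicates `SmoothPoincare4` (P = Sub)
set_option linter.dupNamespace false

namespace Summit.SmoothPoincare4.SmoothPoincare4.Theorems.NilpotentShadowsStandard.Negative

open Literature.Topology.FourManifolds Subgroup
open Summit.SmoothPoincare4.SmoothPoincare4.Theses.CongruenceShadows

/-! ## The shape of a counterexample -/

/-- `Iso N K` gives standard shadows at every level `c` (take `ψ := α`): a counterexample to the crux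
is never isomorphic to the standard trisection. [folklore] -/
theorem shadow_of_iso {m : ℕ} {K : TrisectionKernels (3 + 3 * m)}
    (h : TrisectionKernels.Iso (s4Kernels.stabilizeIter m) K) (c : ℕ) :
    ∃ ψ : SurfaceGroup (3 + 3 * m) ≃* SurfaceGroup (3 + 3 * m), ∀ i : Fin 3,
      (s4Kernels.stabilizeIter m i ⊔
          (⊤ : Subgroup (SurfaceGroup (3 + 3 * m))).lowerCentralSeries (c + 1)).map ψ.toMonoidHom =
        K i ⊔ (⊤ : Subgroup (SurfaceGroup (3 + 3 * m))).lowerCentralSeries (c + 1) := by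
  obtain ⟨α, hα⟩ := h
  refine ⟨α, fun i => ?_⟩
  rw [Subgroup.map_sup, hα i, map_lcs_top_equiv]

/-- Shadows are monotone in the level: a standard shadow at level `c` is standard at every
`c' ≤ c` (`γ_{c+2} ≤ γ_{c'+2}`), with the same automorphism. [folklore] -/
theorem shadow_mono {m : ℕ} {K : TrisectionKernels (3 + 3 * m)} {c c' : ℕ} (hc : c' ≤ c)
    (h : ∃ ψ : SurfaceGroup (3 + 3 * m) ≃* SurfaceGroup (3 + 3 * m), ∀ i : Fin 3,
      (s4Kernels.stabilizeIter m i ⊔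
          (⊤ : Subgroup (SurfaceGroup (3 + 3 * m))).lowerCentralSeries (c + 1)).map ψ.toMonoidHom =
        K i ⊔ (⊤ : Subgroup (SurfaceGroup (3 + 3 * m))).lowerCentralSeries (c + 1)) :
    ∃ ψ : SurfaceGroup (3 + 3 * m) ≃* SurfaceGroup (3 + 3 * m), ∀ i : Fin 3,
      (s4Kernels.stabilizeIter m i ⊔
          (⊤ : Subgroup (SurfaceGroup (3 + 3 * m))).lowerCentralSeries (c' + 1)).map ψ.toMonoidHom =
        K i ⊔ (⊤ : Subgroup (SurfaceGroup (3 + 3 * m))).lowerCentralSeries (c' + 1) := by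
  obtain ⟨ψ, hψ⟩ := h
  have hle : (⊤ : Subgroup (SurfaceGroup (3 + 3 * m))).lowerCentralSeries (c + 1) ≤
      (⊤ : Subgroup (SurfaceGroup (3 + 3 * m))).lowerCentralSeries (c' + 1) :=
    Subgroup.lowerCentralSeries_antitone ⊤ (Nat.succ_le_succ hc)
  refine ⟨ψ, fun i => ?_⟩
  have e1 : s4Kernels.stabilizeIter m i ⊔
        (⊤ : Subgroup (SurfaceGroup (3 + 3 * m))).lowerCentralSeries (c' + 1) =
      (s4Kernels.stabilizeIter m i ⊔ (⊤ : Subgroup (SurfaceGroup (3 + 3 * m))).lowerCentralSeries (c + 1)) ⊔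
        (⊤ : Subgroup (SurfaceGroup (3 + 3 * m))).lowerCentralSeries (c' + 1) := by
    rw [sup_assoc, sup_eq_right.2 hle]
  have e2 : K i ⊔ (⊤ : Subgroup (SurfaceGroup (3 + 3 * m))).lowerCentralSeries (c' + 1) =
      (K i ⊔ (⊤ : Subgroup (SurfaceGroup (3 + 3 * m))).lowerCentralSeries (c + 1)) ⊔
        (⊤ : Subgroup (SurfaceGroup (3 + 3 * m))).lowerCentralSeries (c' + 1) := by
    rw [sup_assoc, sup_eq_right.2 hle]
  rw [e1, e2, Subgroup.map_sup, hψ i, map_lcs_top_equiv]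

/-- WHAT A COUNTEREXAMPLE MUST BE: `¬ NilpotentShadowsStandard` yields a `(3+3m, m+1)` group
trisection `K` of the trivial group (a genus-`(3+3m)` trisection of a homotopy 4-sphere, AGK Thm 5)
that is NOT `Iso` to the standard one, with a threshold `c₀`: shadows standard below `c₀`, non-standard
from `c₀` on. [folklore] -/
theorem counterexample_shape (h : ¬ NilpotentShadowsStandard) :
    ∃ (m : ℕ) (K : TrisectionKernels (3 + 3 * m)) (c₀ : ℕ),
      IsGroupTrisection (3 + 3 * m) (m + 1) (PUnit : Type) K ∧
      ¬ TrisectionKernels.Iso (s4Kernels.stabilizeIter m) K ∧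
      (∀ c, c < c₀ → ∃ ψ : SurfaceGroup (3 + 3 * m) ≃* SurfaceGroup (3 + 3 * m), ∀ i : Fin 3,
        (s4Kernels.stabilizeIter m i ⊔
            (⊤ : Subgroup (SurfaceGroup (3 + 3 * m))).lowerCentralSeries (c + 1)).map ψ.toMonoidHom =
          K i ⊔ (⊤ : Subgroup (SurfaceGroup (3 + 3 * m))).lowerCentralSeries (c + 1)) ∧
      (∀ c, c₀ ≤ c → ¬ ∃ ψ : SurfaceGroup (3 + 3 * m) ≃* SurfaceGroup (3 + 3 * m), ∀ i : Fin 3,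
        (s4Kernels.stabilizeIter m i ⊔
            (⊤ : Subgroup (SurfaceGroup (3 + 3 * m))).lowerCentralSeries (c + 1)).map ψ.toMonoidHom =
          K i ⊔ (⊤ : Subgroup (SurfaceGroup (3 + 3 * m))).lowerCentralSeries (c + 1)) := by
  have h' : ∃ (m : ℕ) (K : TrisectionKernels (3 + 3 * m)),
      IsGroupTrisection (3 + 3 * m) (m + 1) (PUnit : Type) K ∧ ∃ c : ℕ,
        ¬ ∃ ψ : SurfaceGroup (3 + 3 * m) ≃* SurfaceGroup (3 + 3 * m), ∀ i : Fin 3,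
          (s4Kernels.stabilizeIter m i ⊔
              (⊤ : Subgroup (SurfaceGroup (3 + 3 * m))).lowerCentralSeries (c + 1)).map ψ.toMonoidHom =
            K i ⊔ (⊤ : Subgroup (SurfaceGroup (3 + 3 * m))).lowerCentralSeries (c + 1) := by
    by_contra hcon
    apply h
    intro m K hK c
    by_contra hc
    exact hcon ⟨m, K, hK, c, hc⟩
  obtain ⟨m, K, hK, hbad⟩ := h'
  classical
  refine ⟨m, K, Nat.find hbad, hK, fun hiso => Nat.find_spec hbad (shadow_of_iso hiso _),
    fun c hc => ?_, fun c hc hsh => Nat.find_spec hbad (shadow_mono hc hsh)⟩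
  by_contra hnot
  exact Nat.find_min hbad hc hnot


end Summit.SmoothPoincare4.SmoothPoincare4.Theorems.NilpotentShadowsStandard.Negative

end
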